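import Literature.Probability.Percolation.VerticalTransportBound
import Literature.Probability.Percolation.StripDictionary
import HarnessLib

/-!
# Transport of vertical crossings (GM14 Proposition 6.8) — V: back to `G_{α,β}`

This file carries the conclusion of `VerticalTransportBound.vertical_transport_strip` from the
strip model (`SV = Option (ℤ × ℤ)`, weights `canonicalWeight`) to the tree's isoradial square
lattice on the abstract `ℤ²` (`Site 2`, product measure `prodBernoulli (gmWeight α rows)` =
GM14's `P_{α,rows}`, `IsoradialSquareLatticeGM`), along the dictionary of `HorizontalTransportGM`
(`toStrip`, `map_toStrip`, `isWalk_map_gmLabel`, `isLatticeWalk_map_siteOf`):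

* `cvInitGM N` — a vertical crossing of GM14's box `B(N, N) = {|i| ≤ N, 0 ≤ y ≤ N}` (diamond
  coordinates `(i, y) = (x₀ - x₁, x₀ + x₁)`): an open path of the box from height `0` to height `N`;
  `cvFinalGM N u` — an open path inside `{|i| ≤ 3N + u + 2, 0 ≤ y ≤ u}` from height `0` to height `u`
  (a vertical crossing of a `(6N + 2u + 4) × u` box; GM14: `C_v[B(4N, δN)]`);
* **`VData.vertical_transport_gm`** — GM14 Proposition 6.8 in diamond coordinates: for valid data
  (`BAC(ε)` for `ξ` and every `β_k` on a strip of half-width `M ≥ 4N + 4`) and `u ≤ θ(ε)N/2`,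
  `(θ(ε)/2) · P_{α,β̃}(cvInitGM N) ≤ P_{α,rows N²}(cvFinalGM N u)`, where `β̃ = rowV 0 0` carries the
  regular angle `ξ` on all levels `< N` (so that `cvInitGM N` is an event of `G_{α,ξ}`) and
  `rows N² = rowV N 0` carries `β_0, …, β_{N-1}` on the levels `0, …, N-1` (so that `cvFinalGM N u` is
  an event of `G_{α,β}`); `θ(ε)/2 = ¼ sin³(ε/3)` in place of the printed `c_N`.

## References

* G. R. Grimmett, I. Manolescu, PTRF 159 (2014) 273–327, arXiv:1204.0505, §4.6 (`G_{α,β}`,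
  `P_{α,β}`, boxes `B(M, N)` and vertical crossings `C_v`), §6.3 Proposition 6.8.
-/

noncomputable section

namespace Literature.Probability.Percolation

open LatticeModels StarTriangle Real MeasureTheory

namespace TrackExchange

namespace VData

variable (V : VData)

/-- **The initial crossing forces the initial record** (read off on the strip). [cite: GrimmettManolescu2014Isoradial, §6.3] -/
theorem cvInitGM_subset_preimage (hM : V.N < V.M) :
    cvInitGM V.N ⊆ toStrip V.M ⁻¹' {ω | hRec (V.DomT 0) V.N ω = V.N} := by
  rintro ω ⟨L, hL, ⟨a, ha, ha0⟩, ⟨b, hb, hbN⟩, hbox⟩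
  refine V.hRec_eq_of_crossing (W := L.map gmLabel) (isWalk_map_gmLabel hL fun x hx => ?_) (fun z hz => ?_)
    ⟨(col a, hgtOf a), by rw [List.head?_map, ha]; rfl, ha0⟩ ⟨(col b, hgtOf b), by rw [List.getLast?_map, hb]; rfl, hbN⟩
  · have := (hbox x hx).1; rw [abs_le] at this; constructor <;> omega
  · rw [List.mem_map] at hz
    obtain ⟨x, hx, rfl⟩ := hz
    exact ⟨(col x, hgtOf x), rfl, hbox x hx⟩

/-- **The final record yields the target crossing** (clean read-off configuration). [cite: GrimmettManolescu2014Isoradial, §6.3] -/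
theorem preimage_inter_subset_cvFinalGM (u : ℕ) :
    toStrip V.M ⁻¹' ({ω | u ≤ hRec (V.DomT (V.N * V.N)) V.N ω} ∩ {ω | Clean (V.weightsT (V.N * V.N)) ω}) ⊆ cvFinalGM V.N u := by
  rintro ω ⟨hu, hc⟩
  by_cases hu0 : u = 0
  · -- the one-site path at the origin
    subst hu0
    refine ⟨[0], trivial, ⟨0, rfl, by simp [hgtOf]⟩, ⟨0, rfl, by simp [hgtOf]⟩, fun x hx => ?_⟩
    simp only [List.mem_singleton] at hx
    subst hx
    simp only [col, hgtOf]
    refine ⟨by simp; positivity, by simp, by simp⟩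
  obtain ⟨W, hW, hbox, ⟨a, ha, ha0⟩, ⟨b, hb, hbu⟩⟩ := V.crossing_of_le_hRec hc hu
  have hn : none ∉ W := fun h => by obtain ⟨a', ha', -⟩ := hbox _ h; simp at ha'
  -- at least two vertices (heights `0 ≠ u` at the ends), so all labels are primal
  have hlen : 2 ≤ W.length := by
    by_contra hlt
    push Not at hlt
    rcases W with _ | ⟨v, _ | ⟨w, l⟩⟩
    · simp at ha
    · simp only [List.head?_cons, Option.some.injEq] at ha
      simp only [List.getLast?_singleton, Option.some.injEq] at hb
      rw [ha] at hb
      simp only [Option.some.injEq] at hb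
      rw [hb] at ha0
      omega
    · simp at hlt
  have hpar : ∀ m y, some (m, y) ∈ W → Even (m + y) := fun m y hm => even_of_mem_of_isWalk hW hn hlen m y hm
  refine ⟨W.map siteOf, isLatticeWalk_map_siteOf hW hn, ?_, ?_, fun x hx => ?_⟩
  · have h0 := hpar a.1 a.2 (List.mem_of_mem_head? ha)
    refine ⟨unlabelSite a, by rw [List.head?_map, ha]; rfl, ?_⟩
    have h := col_hgtOf_unlabelSite h0
    rw [h.2, ha0]
  · have h0 := hpar b.1 b.2 (List.mem_of_getLast? hb)
    refine ⟨unlabelSite b, by rw [List.getLast?_map, hb]; rfl, ?_⟩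
    have h := col_hgtOf_unlabelSite h0
    rw [h.2, hbu]
  · rw [List.mem_map] at hx
    obtain ⟨z, hz, rfl⟩ := hx
    obtain ⟨c, rfl, hc1, hc2, hc3⟩ := hbox z hz
    have h := col_hgtOf_unlabelSite (hpar c.1 c.2 hz)
    simp only [siteOf]
    rw [h.1, h.2]
    exact ⟨hc1, hc2, hc3⟩

/-! ### Proposition 6.8 on `ℤ²` -/

variable {V}

/-- **Transport of vertical crossings through the irregular block** (GM14 Proposition 6.8 in
diamond coordinates): for valid data `V` (`BAC(ε)` for `ξ` and every `β_k` on a strip of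
half-width `M ≥ 4N + 4`) and `u ≤ θ(ε)N/2`,
`(θ(ε)/2) · P_{α,β̃}(cvInitGM N) ≤ P_{α,rows}(cvFinalGM N u)` with `β̃ = V.rowV 0 0` (regular angle on
the levels `< N`) and `rows = V.rowV N 0` (`β_0, …, β_{N-1}` on the levels `0, …, N-1`).
[cite: GrimmettManolescu2014Isoradial, §6.3 Proposition 6.8] -/
theorem vertical_transport_gm {ε : ℝ} (hV : V.Valid ε) (hM : 4 * V.N + 4 ≤ V.M) {u : ℕ} (hu : (u : ℝ) ≤ θ ε * V.N / 2) :
    ENNReal.ofReal (θ ε / 2) * prodBernoulli (Percolation.gmWeight V.α (V.rowV 0 0)) (cvInitGM V.N) ≤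
      prodBernoulli (Percolation.gmWeight V.α (V.rowV V.N 0)) (cvFinalGM V.N u) := by
  obtain ⟨hθ0, -⟩ := θ_pos_le hV.ε_pos hV.ε_lt
  have hstrip := vertical_transport_strip hV hM hu
  -- the strip measures are read off `ℤ²`
  have hNN : V.N * V.N / V.N = V.N := by
    rcases Nat.eq_zero_or_pos V.N with h | h
    · simp [h]
    · exact Nat.mul_div_cancel_left _ h
  have h0 : V.μt 0 = (prodBernoulli (Percolation.gmWeight V.α (V.rowV 0 0))).map (toStrip V.M) := by
    rw [μt, weightsT, map_toStrip]; simp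
  have hF : V.μt (V.N * V.N) = (prodBernoulli (Percolation.gmWeight V.α (V.rowV V.N 0))).map (toStrip V.M) := by
    rw [μt, weightsT, map_toStrip, hNN, Nat.mul_mod_left]
  set A := {ω : Set (Sym2 SV) | hRec (V.DomT 0) V.N ω = V.N} with hA
  set B := {ω : Set (Sym2 SV) | u ≤ hRec (V.DomT (V.N * V.N)) V.N ω} with hB
  set C := {ω : Set (Sym2 SV) | Clean (V.weightsT (V.N * V.N)) ω} with hC
  have hAm : MeasurableSet A := measurableSet_hRec_eq _ _ _
  have hBm : MeasurableSet B := measurableSet_le measurable_const (measurable_hRec _ _)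
  have hCm : MeasurableSet C := measurableSet_setOf_clean _
  -- in `ENNReal`
  have hstrip' : ENNReal.ofReal (θ ε / 2) * V.μt 0 A ≤ V.μt (V.N * V.N) B := by
    have h1 : ENNReal.ofReal (θ ε / 2 * (V.μt 0).real A) ≤ ENNReal.ofReal ((V.μt (V.N * V.N)).real B) :=
      ENNReal.ofReal_le_ofReal hstrip
    rwa [ENNReal.ofReal_mul (by linarith), ofReal_measureReal, ofReal_measureReal] at h1
  -- the final event, up to the null set of unclean configurations
  have hBC : V.μt (V.N * V.N) B = V.μt (V.N * V.N) (B ∩ C) := by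
    rw [μt, hC, prodBernoulli_inter_setOf_clean]
  calc ENNReal.ofReal (θ ε / 2) * prodBernoulli (Percolation.gmWeight V.α (V.rowV 0 0)) (cvInitGM V.N)
      ≤ ENNReal.ofReal (θ ε / 2) * prodBernoulli (Percolation.gmWeight V.α (V.rowV 0 0)) (toStrip V.M ⁻¹' A) :=
        mul_le_mul' le_rfl (measure_mono (V.cvInitGM_subset_preimage (by omega)))
    _ = ENNReal.ofReal (θ ε / 2) * V.μt 0 A := by rw [h0, Measure.map_apply (measurable_toStrip _) hAm]
    _ ≤ V.μt (V.N * V.N) (B ∩ C) := hBC ▸ hstrip'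
    _ = prodBernoulli (Percolation.gmWeight V.α (V.rowV V.N 0)) (toStrip V.M ⁻¹' (B ∩ C)) := by
        rw [hF, Measure.map_apply (measurable_toStrip _) (hBm.inter hCm)]
    _ ≤ prodBernoulli (Percolation.gmWeight V.α (V.rowV V.N 0)) (cvFinalGM V.N u) :=
        measure_mono (V.preimage_inter_subset_cvFinalGM u)

end VData

end TrackExchange

end Literature.Probability.Percolation
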